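import Summits.BirchSwinnertonDyer.Rank1Residual.Additive.X3GordBranchPAdicGrossZagier
import Summits.BirchSwinnertonDyer.Rank1Residual.AdditivePotMult.X3MBranchPAdicGrossZagier
import Summits.BirchSwinnertonDyer.Rank1Residual.Additive.X3RankZeroSemistableTwist
import Summits.BirchSwinnertonDyer.Rank1Residual.Additive.GordThreeDelbourgo2002Bridge
import Summits.BirchSwinnertonDyer.Rank1Residual.AdditivePotMult.PotMultDelbourgo2002Bridge
import HarnessLib

/-!
# (S10) Unit-literal rank-ONE class corollaries: `BSD(E,p)` on the O7 semistable-twist rows with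
# `p ∤ #Ш_an(E)` from the hna-FREE UPPER halves alone (cell `b2b-bsdres`, team n1011, seat p16;
# sub-target (S10) of route planner 3, ROUTE-3.md l.61; written on the lead's deal)

HONEST FRAMING (cell `b2b-bsdres`, run/shared/lean/b2b/bsd-rank1-residual/, verbatim in every
file): the goal of the cell is to DELETE the COMBINATION-SHAPED residual classes of the
Birch–Swinnerton-Dyer formula for ALL analytic-rank `≤ 1` elliptic curves over `ℚ` — "full BSD
formula for every rank `≤ 1` curve in class `C`" assembled STRICTLY from published theorems — so
that the rank-`≤ 1` remainder becomes exactly the CONSTRUCTION-SHAPED classes, which are TYPED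
(missing-input `Prop`s), NOT attempted. This is not "finishing BSD". Team n1011 (N10 / N11 / O7),
seat p16: research route; the labels of X3 / X4 and the N10 / N11 / O7 marks are UNCHANGED by this
file; nothing is booked here; no Literature fact is minted.

Theorems only (no `def`, no `sorry`, no new named fact); three-line bookkeeping corollaries. On an
additive potentially semistable rank-ONE row, the cell's UPPER halves `ord_p #Ш ≤ ord_p #Ш_an` are
hna-FREE, certificate-FREE and LOWER-wall-FREE (seat p01's `ClassX4Gord.missingUpperBoundAt_rankOne_…`
over Kato's half-eigen reading, p254996 / `BranchPAdicGrossZagierUpperHalf`; seat p12's X3 / (M) twins over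
Wuthrich's Thm. 16 half, `X3GordBranchPAdicGrossZagier`, `X3MBranchPAdicGrossZagier`); when moreover the
analytic order of `Ш` is a `p`-adic UNIT (`hq : shaAn W = q`, `hv : ord_p q = 0` — census LITERALS per row,
EVIDENCE when instantiated, exactly the currency of the rank-`0` forms `X4RankZero.bsdp_of_shaAn_unit`,
`ClassX3.bsdp_three_of_semistableTwist_of_shaAn_units`), the one-sided bound pinches
`0 ≤ ord_p #Ш ≤ ord_p #Ш_an = 0`, i.e. Miller's `BSD(E,p)` (`missingPPartAt_of_upper_of_shaAn_unit`,
`Typed.bsdp_of_missingPPartAt`). The remaining non-fact inputs are the row's typed `p`-adic Gross–Zagier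
(`BranchPAdicGrossZagier[Odd|Mult]At W p Dh`), the Schneider rider `hS` and a Delbourgo (B)-datum `hB`.
Route planner 3's sizing (ROUTE-3 l.60–61, zero compute): at `p = 3`, `N < 5·10⁵` these corollaries reach
every `surj ∧ tower` O7-ord ∩ X4@3 rank-one row with `3 ∤ #Ш_an(W)` = 3 456 / 3 496, in particular all
1 561 anomalous unit rows (where no ℚ-side CERT iff applies); the residue at this grade is exactly the 40
rows with `3 ∣ #Ш_an(W)`, owned by (S8) / the CERT-iff kernels / p12's PotMult kernels.

* `ClassX4Gord.bsdp_rankOne_of_katoHalf_of_branchPAdicGrossZagierOdd_of_shaAn_unit` (`p ≡ 3 (mod 4)`, incl. `3`);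
* `ClassX4Gord.bsdp_rankOne_of_katoHalf_of_schneider_of_branchPAdicGrossZagier_of_shaAn_unit` (`p ≡ 1 (mod 4)`);
* `ClassX4M.bsdp_rankOne_of_katoHalf_of_branchPAdicGrossZagierMult_of_shaAn_unit` (every odd `p`);
* `ClassX3Gord.bsdp_rankOne_of_wuthrichHalf_of_branchPAdicGrossZagierOdd_of_shaAn_unit`,
  `ClassX3Gord.bsdp_rankOne_of_wuthrichHalf_of_schneider_of_branchPAdicGrossZagier_of_shaAn_unit`,
  `ClassX3M.bsdp_rankOne_of_wuthrichHalf_of_branchPAdicGrossZagierMult_of_shaAn_unit` (the X3♯ twins);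
* `p = 3` convenience forms (`e = 2` automatic): `ClassX4Gord.bsdp_three_rankOne_…Odd_of_shaAn_unit`,
  `ClassX3Gord.bsdp_three_rankOne_…Odd_of_shaAn_unit`;
* `∀ Dh` forms with Delbourgo 2002 SUPPLYING the (B)-datum (`…_of_delbourgo_of_forall_…_of_shaAn_unit`: X4♯(G-ord)@3
  / X3♯(G-ord)@3 via `ClassX4Gord/ClassX3Gord.delbourgo2002_three` (`hDel3`, non-CM binder `hcm`), X4(M) / X3♯(M)
  via `ClassX4M/ClassX3M.delbourgo2002` (`hDelM`, every odd `p`)) — the hypothesis shape `hGZ : ∀ Dh,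
  LeadingTermClauses → SchneiderConjecture Dh ∧ BranchPAdicGrossZagier…At W p Dh` of the T-O7 class forms.

Cross-check: the six spec corollaries have binder lists identical to seat n1011-p17's independently written,
yielded draft (`HOME/b2b-bsdres-n1011-p17/lean/BranchPAdicGrossZagierRankOneShaAnUnit.lean`, not proposed).
References: [Kato2004Asterisque] Thm. 17.4; [Wuthrich2014] Thm. 16; [Delbourgo2002] Thm. (B);
[Miller2011LMS] Def. 1.1.
-/

noncomputable section

open scoped Classical MatrixGroups ModularForm NumberField

open CongruenceSubgroup WeierstrassCurve NumberField Literature.NumberTheory.EllipticCurves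
  Literature.NumberTheory.EllipticCurves.ModularForms
  Literature.NumberTheory.EllipticCurves.Rank1Residual
  Literature.NumberTheory.EllipticCurves.Rank1Residual.Typed
  Literature.NumberTheory.EllipticCurves.Delbourgo2002

namespace Summit.BirchSwinnertonDyer.Rank1Residual.Additive

variable {W : WeierstrassCurve ℚ} [W.IsElliptic] [W.IsGloballyMinimal] {p : ℕ} [Fact p.Prime]

/-- **X4♯(G-ord, `e = 2`) ∧ surj, `r_an = 1`, `p ≡ 3 (mod 4)` (incl. `p = 3`), `p ∤ #Ш_an(E)`: `BSD(E,p)`**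
from the hna-free UPPER half (seat p01, Kato's half-eigen reading `hK` + (B)-datum `hB` + rider `hS` +
the typed odd-branch `p`-adic Gross–Zagier `hGZ`) and the unit literal (`hq`, `hv`).
[cite: Kato2004Asterisque, Thm. 17.4] [cite: Delbourgo2002, Theorem (B) (p. 40)] [cite: Miller2011LMS, Def. 1.1] -/
theorem ClassX4Gord.bsdp_rankOne_of_katoHalf_of_branchPAdicGrossZagierOdd_of_shaAn_unit
    (hK : Wuthrich2014.kato_halfEigenCharIdeal_dvd_cyclotomicPrime_of_surjective)
    (hGZK : rank_eq_analyticRank_of_analyticRank_le_one) (hmod : hasEntireLFunction_rat)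
    (hmodD : nonempty_modularParametrizationData) (hX : ClassX4Gord W p)
    (he : semistabilityIndex W p = 2) (hp4 : p % 4 = 3) (hsurj : Surj W p) (hr : W.analyticRank = 1)
    {Dh : PAdicHeightData W p} (hB : LeadingTermClauses W p Dh) (hS : SchneiderConjecture Dh)
    (hGZ : BranchPAdicGrossZagierOddAt W p Dh) {q : ℚ} (hq : shaAn W = (q : ℂ)) (hv : padicValRat p q = 0) :
    BSDp W p :=
  bsdp_of_missingPPartAt W p hGZK (by rw [hr]) (missingPPartAt_of_upper_of_shaAn_unit W p
    (ClassX4Gord.missingUpperBoundAt_rankOne_of_katoHalf_of_branchPAdicGrossZagierOdd hK hGZK hmod hmodD hX he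
      hp4 hsurj hr hB hS hGZ) hq hv)

/-- **X4♯(G-ord, `e = 2`) ∧ surj, `r_an = 1`, `p ≡ 1 (mod 4)`, `p ∤ #Ш_an(E)`: `BSD(E,p)`** from the hna-free
UPPER half on the even branch (seat p01; Kato's half `hK`, `hB`, rider `hS`, typed `hGZ : BranchPAdicGrossZagierAt`)
and the unit literal. [cite: Kato2004Asterisque, Thm. 17.4] [cite: Delbourgo2002, Theorem (B) (p. 40)]
[cite: Miller2011LMS, Def. 1.1] -/
theorem ClassX4Gord.bsdp_rankOne_of_katoHalf_of_schneider_of_branchPAdicGrossZagier_of_shaAn_unit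
    (hK : Wuthrich2014.kato_halfEigenCharIdeal_dvd_cyclotomicPrime_of_surjective)
    (hGZK : rank_eq_analyticRank_of_analyticRank_le_one) (hmod : hasEntireLFunction_rat)
    (hmodD : nonempty_modularParametrizationData) (hX : ClassX4Gord W p)
    (he : semistabilityIndex W p = 2) (hp4 : p % 4 = 1) (hsurj : Surj W p) (hr : W.analyticRank = 1)
    {Dh : PAdicHeightData W p} (hB : LeadingTermClauses W p Dh) (hS : SchneiderConjecture Dh)
    (hGZ : BranchPAdicGrossZagierAt W p Dh) {q : ℚ} (hq : shaAn W = (q : ℂ)) (hv : padicValRat p q = 0) :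
    BSDp W p :=
  bsdp_of_missingPPartAt W p hGZK (by rw [hr]) (missingPPartAt_of_upper_of_shaAn_unit W p
    (ClassX4Gord.missingUpperBoundAt_rankOne_of_katoHalf_of_schneider_of_branchPAdicGrossZagier hK hGZK hmod
      hmodD hX he hp4 hsurj hr hB hS hGZ) hq hv)

/-- **X3♯(G-ord, `e = 2`), `r_an = 1`, `p ≡ 3 (mod 4)`, `p ∤ #Ш_an(E)`: `BSD(E,p)`** from the UPPER half over
Wuthrich's Thm. 16 integral half (`hWu`; seat p12's X3♯ twin), `hB`, rider `hS`, typed odd-branch GZ `hGZ`,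
and the unit literal — no image hypothesis. [cite: Wuthrich2014, Thm. 16 (p. 397)]
[cite: Delbourgo2002, Theorem (B) (p. 40)] [cite: Miller2011LMS, Def. 1.1] -/
theorem ClassX3Gord.bsdp_rankOne_of_wuthrichHalf_of_branchPAdicGrossZagierOdd_of_shaAn_unit
    (hWu : Wuthrich2014.thm16_halfEigenCharIdeal_dvd_cyclotomicPrime)
    (hGZK : rank_eq_analyticRank_of_analyticRank_le_one) (hmod : hasEntireLFunction_rat)
    (hmodD : nonempty_modularParametrizationData) (hX : ClassX3Gord W p)
    (he : semistabilityIndex W p = 2) (hp4 : p % 4 = 3) (hr : W.analyticRank = 1)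
    {Dh : PAdicHeightData W p} (hB : LeadingTermClauses W p Dh) (hS : SchneiderConjecture Dh)
    (hGZ : BranchPAdicGrossZagierOddAt W p Dh) {q : ℚ} (hq : shaAn W = (q : ℂ)) (hv : padicValRat p q = 0) :
    BSDp W p :=
  bsdp_of_missingPPartAt W p hGZK (by rw [hr]) (missingPPartAt_of_upper_of_shaAn_unit W p
    (ClassX3Gord.missingUpperBoundAt_rankOne_of_wuthrichHalf_of_branchPAdicGrossZagierOdd hWu hGZK hmod hmodD
      hX he hp4 hr hB hS hGZ) hq hv)

/-- **X3♯(G-ord, `e = 2`), `r_an = 1`, `p ≡ 1 (mod 4)`, `p ∤ #Ш_an(E)`: `BSD(E,p)`** from the UPPER half over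
Wuthrich's Thm. 16 integral half on the even branch (`hWu`, `hB`, `hS`, typed `hGZ : BranchPAdicGrossZagierAt`)
and the unit literal. [cite: Wuthrich2014, Thm. 16 (p. 397)] [cite: Delbourgo2002, Theorem (B) (p. 40)]
[cite: Miller2011LMS, Def. 1.1] -/
theorem ClassX3Gord.bsdp_rankOne_of_wuthrichHalf_of_schneider_of_branchPAdicGrossZagier_of_shaAn_unit
    (hWu : Wuthrich2014.thm16_halfEigenCharIdeal_dvd_cyclotomicPrime)
    (hGZK : rank_eq_analyticRank_of_analyticRank_le_one) (hmod : hasEntireLFunction_rat)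
    (hmodD : nonempty_modularParametrizationData) (hX : ClassX3Gord W p)
    (he : semistabilityIndex W p = 2) (hp4 : p % 4 = 1) (hr : W.analyticRank = 1)
    {Dh : PAdicHeightData W p} (hB : LeadingTermClauses W p Dh) (hS : SchneiderConjecture Dh)
    (hGZ : BranchPAdicGrossZagierAt W p Dh) {q : ℚ} (hq : shaAn W = (q : ℂ)) (hv : padicValRat p q = 0) :
    BSDp W p :=
  bsdp_of_missingPPartAt W p hGZK (by rw [hr]) (missingPPartAt_of_upper_of_shaAn_unit W p
    (ClassX3Gord.missingUpperBoundAt_rankOne_of_wuthrichHalf_of_schneider_of_branchPAdicGrossZagier hWu hGZK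
      hmod hmodD hX he hp4 hr hB hS hGZ) hq hv)

/-- **At `p = 3`** (N11's grade; `e = 2` automatic for type (G) at `3`, `semistabilityIndex_eq_two_of_typeG_three`):
X4♯(G-ord)@3 ∧ surj(3), `r_an = 1`, `3 ∤ #Ш_an(E)` ⟹ `BSD(E,3)` from the hna-free UPPER half + the unit literal.
[cite: Kato2004Asterisque, Thm. 17.4] [cite: Delbourgo2002, Theorem (B) (p. 40)] [cite: Miller2011LMS, Def. 1.1] -/
theorem ClassX4Gord.bsdp_three_rankOne_of_katoHalf_of_branchPAdicGrossZagierOdd_of_shaAn_unit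
    {W : WeierstrassCurve ℚ} [W.IsElliptic] [W.IsGloballyMinimal] [Fact (Nat.Prime 3)]
    (hK : Wuthrich2014.kato_halfEigenCharIdeal_dvd_cyclotomicPrime_of_surjective)
    (hGZK : rank_eq_analyticRank_of_analyticRank_le_one) (hmod : hasEntireLFunction_rat)
    (hmodD : nonempty_modularParametrizationData) (hX : ClassX4Gord W 3) (hsurj : Surj W 3)
    (hr : W.analyticRank = 1) {Dh : PAdicHeightData W 3} (hB : LeadingTermClauses W 3 Dh)
    (hS : SchneiderConjecture Dh) (hGZ : BranchPAdicGrossZagierOddAt W 3 Dh)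
    {q : ℚ} (hq : shaAn W = (q : ℂ)) (hv : padicValRat 3 q = 0) : BSDp W 3 :=
  ClassX4Gord.bsdp_rankOne_of_katoHalf_of_branchPAdicGrossZagierOdd_of_shaAn_unit hK hGZK hmod hmodD hX
    (semistabilityIndex_eq_two_of_typeG_three W hX.typeGOrd.typeG hX.addv.2) (by norm_num) hsurj hr hB hS hGZ hq hv

/-- **At `p = 3`**: X3♯(G-ord)@3, `r_an = 1`, `3 ∤ #Ш_an(E)` ⟹ `BSD(E,3)` from Wuthrich's half + the unit literal
(no image hypothesis; `e = 2` automatic). [cite: Wuthrich2014, Thm. 16 (p. 397)] [cite: Miller2011LMS, Def. 1.1] -/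
theorem ClassX3Gord.bsdp_three_rankOne_of_wuthrichHalf_of_branchPAdicGrossZagierOdd_of_shaAn_unit
    {W : WeierstrassCurve ℚ} [W.IsElliptic] [W.IsGloballyMinimal] [Fact (Nat.Prime 3)]
    (hWu : Wuthrich2014.thm16_halfEigenCharIdeal_dvd_cyclotomicPrime)
    (hGZK : rank_eq_analyticRank_of_analyticRank_le_one) (hmod : hasEntireLFunction_rat)
    (hmodD : nonempty_modularParametrizationData) (hX : ClassX3Gord W 3) (hr : W.analyticRank = 1)
    {Dh : PAdicHeightData W 3} (hB : LeadingTermClauses W 3 Dh) (hS : SchneiderConjecture Dh)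
    (hGZ : BranchPAdicGrossZagierOddAt W 3 Dh) {q : ℚ} (hq : shaAn W = (q : ℂ)) (hv : padicValRat 3 q = 0) :
    BSDp W 3 :=
  ClassX3Gord.bsdp_rankOne_of_wuthrichHalf_of_branchPAdicGrossZagierOdd_of_shaAn_unit hWu hGZK hmod hmodD hX
    (semistabilityIndex_eq_two_of_typeG_three W hX.typeGOrd.typeG hX.addv) (by norm_num) hr hB hS hGZ hq hv

/-- **`∀ Dh` form at `p = 3` on X4♯(G-ord) WITH Delbourgo 2002 (A)+(B) at `3` supplying the (B)-datum**
(`hDel3 : Delbourgo2002.mainTheorem_three`, non-CM binder `hcm` explicit; bridge `ClassX4Gord.delbourgo2002_three`):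
X4♯(G-ord)@3 ∧ surj(3), `r_an = 1`, UNIT row, and the typed odd-branch GZ WITH the rider for every (B)-datum
⟹ `BSD(E,3)`. [cite: Delbourgo2002, Theorem (A), (B) (p. 40)] [cite: Kato2004Asterisque, Thm. 17.4]
[cite: Miller2011LMS, Def. 1.1] -/
theorem ClassX4Gord.bsdp_three_rankOne_of_katoHalf_of_delbourgo_of_forall_branchPAdicGrossZagierOdd_of_shaAn_unit
    {W : WeierstrassCurve ℚ} [W.IsElliptic] [W.IsGloballyMinimal] [Fact (Nat.Prime 3)]
    (hDel3 : Delbourgo2002.mainTheorem_three)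
    (hK : Wuthrich2014.kato_halfEigenCharIdeal_dvd_cyclotomicPrime_of_surjective)
    (hGZK : rank_eq_analyticRank_of_analyticRank_le_one) (hmod : hasEntireLFunction_rat)
    (hmodD : nonempty_modularParametrizationData) (hX : ClassX4Gord W 3) (hcm : ¬ W.HasCM) (hsurj : Surj W 3)
    (hr : W.analyticRank = 1)
    (hGZ : ∀ Dh : PAdicHeightData W 3, LeadingTermClauses W 3 Dh →
      SchneiderConjecture Dh ∧ BranchPAdicGrossZagierOddAt W 3 Dh)
    {q : ℚ} (hq : shaAn W = (q : ℂ)) (hv : padicValRat 3 q = 0) : BSDp W 3 := by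
  obtain ⟨-, Dh, hB⟩ := hX.delbourgo2002_three hDel3 hcm
  obtain ⟨hS, hGZDh⟩ := hGZ Dh hB
  exact ClassX4Gord.bsdp_three_rankOne_of_katoHalf_of_branchPAdicGrossZagierOdd_of_shaAn_unit hK hGZK hmod hmodD hX
    hsurj hr hB hS hGZDh hq hv

/-- **`∀ Dh` form at `p = 3` on X3♯(G-ord) WITH Delbourgo 2002 at `3` supplying the (B)-datum** (`hDel3`, `hcm`;
bridge `ClassX3Gord.delbourgo2002_three`; NO image hypothesis) ⟹ `BSD(E,3)` on UNIT rows.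
[cite: Delbourgo2002, Theorem (A), (B) (p. 40)] [cite: Wuthrich2014, Thm. 16 (p. 397)] [cite: Miller2011LMS, Def. 1.1] -/
theorem ClassX3Gord.bsdp_three_rankOne_of_wuthrichHalf_of_delbourgo_of_forall_branchPAdicGrossZagierOdd_of_shaAn_unit
    {W : WeierstrassCurve ℚ} [W.IsElliptic] [W.IsGloballyMinimal] [Fact (Nat.Prime 3)]
    (hDel3 : Delbourgo2002.mainTheorem_three)
    (hWu : Wuthrich2014.thm16_halfEigenCharIdeal_dvd_cyclotomicPrime)
    (hGZK : rank_eq_analyticRank_of_analyticRank_le_one) (hmod : hasEntireLFunction_rat)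
    (hmodD : nonempty_modularParametrizationData) (hX : ClassX3Gord W 3) (hcm : ¬ W.HasCM)
    (hr : W.analyticRank = 1)
    (hGZ : ∀ Dh : PAdicHeightData W 3, LeadingTermClauses W 3 Dh →
      SchneiderConjecture Dh ∧ BranchPAdicGrossZagierOddAt W 3 Dh)
    {q : ℚ} (hq : shaAn W = (q : ℂ)) (hv : padicValRat 3 q = 0) : BSDp W 3 := by
  obtain ⟨-, Dh, hB⟩ := hX.delbourgo2002_three hDel3 hcm
  obtain ⟨hS, hGZDh⟩ := hGZ Dh hB
  exact ClassX3Gord.bsdp_three_rankOne_of_wuthrichHalf_of_branchPAdicGrossZagierOdd_of_shaAn_unit hWu hGZK hmod hmodD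
    hX hr hB hS hGZDh hq hv

end Summit.BirchSwinnertonDyer.Rank1Residual.Additive

namespace Summit.BirchSwinnertonDyer.Rank1Residual.AdditivePotMult

open Additive

variable {W : WeierstrassCurve ℚ} [W.IsElliptic] [W.IsGloballyMinimal] {p : ℕ} [Fact p.Prime]

/-- **X4(M) ∧ surj, `r_an = 1`, any odd `p` (incl. `3`), `p ∤ #Ш_an(E)`: `BSD(E,p)`** from the hna-free
UPPER half on the multiplicative branch (seat p01 / p07's Kato certificate line: `hK`, `hB`, rider `hS`,
typed `hGZ : BranchPAdicGrossZagierMultAt`) and the unit literal. [cite: Kato2004Asterisque, Thm. 17.4]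
[cite: Delbourgo2002, Theorem (B) (p. 40)] [cite: Miller2011LMS, Def. 1.1] -/
theorem ClassX4M.bsdp_rankOne_of_katoHalf_of_branchPAdicGrossZagierMult_of_shaAn_unit
    (hK : Wuthrich2014.kato_halfEigenCharIdeal_dvd_cyclotomicPrime_of_surjective)
    (hGZK : rank_eq_analyticRank_of_analyticRank_le_one) (hmod : hasEntireLFunction_rat)
    (hmodD : nonempty_modularParametrizationData) (hX : ClassX4M W p) (hsurj : Surj W p)
    (hr : W.analyticRank = 1)
    {Dh : PAdicHeightData W p} (hB : LeadingTermClauses W p Dh) (hS : SchneiderConjecture Dh)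
    (hGZ : BranchPAdicGrossZagierMultAt W p Dh) {q : ℚ} (hq : shaAn W = (q : ℂ)) (hv : padicValRat p q = 0) :
    BSDp W p :=
  bsdp_of_missingPPartAt W p hGZK (by rw [hr]) (missingPPartAt_of_upper_of_shaAn_unit W p
    (ClassX4M.missingUpperBoundAt_rankOne_of_katoHalf_of_branchPAdicGrossZagierMult hK hGZK hmod hmodD hX hsurj
      hr hB hS hGZ) hq hv)

/-- **X3♯(M), `r_an = 1`, any odd `p`, `p ∤ #Ш_an(E)`: `BSD(E,p)`** from the UPPER half over Wuthrich's
Thm. 16 integral half on the multiplicative branch (`hW16`; seat p12's twin, NO image / tower hypothesis),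
`hB`, rider `hS`, typed `hGZ : BranchPAdicGrossZagierMultAt`, and the unit literal.
[cite: Wuthrich2014, Thm. 16 (p. 397)] [cite: Delbourgo2002, Theorem (B) (p. 40)] [cite: Miller2011LMS, Def. 1.1] -/
theorem ClassX3M.bsdp_rankOne_of_wuthrichHalf_of_branchPAdicGrossZagierMult_of_shaAn_unit
    (hW16 : Wuthrich2014.thm16_halfEigenCharIdeal_dvd_cyclotomicPrime)
    (hGZK : rank_eq_analyticRank_of_analyticRank_le_one) (hmod : hasEntireLFunction_rat)
    (hmodD : nonempty_modularParametrizationData) (hX : ClassX3M W p) (hr : W.analyticRank = 1)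
    {Dh : PAdicHeightData W p} (hB : LeadingTermClauses W p Dh) (hS : SchneiderConjecture Dh)
    (hGZ : BranchPAdicGrossZagierMultAt W p Dh) {q : ℚ} (hq : shaAn W = (q : ℂ)) (hv : padicValRat p q = 0) :
    BSDp W p :=
  bsdp_of_missingPPartAt W p hGZK (by rw [hr]) (missingPPartAt_of_upper_of_shaAn_unit W p
    (ClassX3M.missingUpperBoundAt_rankOne_of_wuthrichHalf_of_branchPAdicGrossZagierMult hW16 hGZK hmod hmodD hX
      hr hB hS hGZ) hq hv)

/-- **`∀ Dh` form on X4(M) WITH Delbourgo 2002 (M) supplying the (B)-datum** (`hDelM : Delbourgo2002.mainTheorem_potMult`,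
every hypothesis discharged on (M) by `ClassX4M.delbourgo2002`; no CM binder; every odd `p` incl. `3`): X4(M) ∧ surj,
`r_an = 1`, UNIT row, and the typed (M)-branch GZ WITH the rider for every (B)-datum ⟹ `BSD(E,p)`.
[cite: Delbourgo2002, Theorem (A), (B) (p. 40)] [cite: Kato2004Asterisque, Thm. 17.4] [cite: Miller2011LMS, Def. 1.1] -/
theorem ClassX4M.bsdp_rankOne_of_katoHalf_of_delbourgo_of_forall_branchPAdicGrossZagierMult_of_shaAn_unit
    (hDelM : Delbourgo2002.mainTheorem_potMult)
    (hK : Wuthrich2014.kato_halfEigenCharIdeal_dvd_cyclotomicPrime_of_surjective)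
    (hGZK : rank_eq_analyticRank_of_analyticRank_le_one) (hmod : hasEntireLFunction_rat)
    (hmodD : nonempty_modularParametrizationData) (hX : ClassX4M W p) (hsurj : Surj W p)
    (hr : W.analyticRank = 1)
    (hGZ : ∀ Dh : PAdicHeightData W p, LeadingTermClauses W p Dh →
      SchneiderConjecture Dh ∧ BranchPAdicGrossZagierMultAt W p Dh)
    {q : ℚ} (hq : shaAn W = (q : ℂ)) (hv : padicValRat p q = 0) : BSDp W p := by
  obtain ⟨-, Dh, hB⟩ := hX.delbourgo2002 hDelM
  obtain ⟨hS, hGZDh⟩ := hGZ Dh hB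
  exact ClassX4M.bsdp_rankOne_of_katoHalf_of_branchPAdicGrossZagierMult_of_shaAn_unit hK hGZK hmod hmodD hX hsurj
    hr hB hS hGZDh hq hv

/-- **`∀ Dh` form on X3♯(M) WITH Delbourgo 2002 (M) supplying the (B)-datum** (`hDelM`, bridge `ClassX3M.delbourgo2002`;
NO image / tower hypothesis; every odd `p`) ⟹ `BSD(E,p)` on UNIT rows.
[cite: Delbourgo2002, Theorem (A), (B) (p. 40)] [cite: Wuthrich2014, Thm. 16 (p. 397)] [cite: Miller2011LMS, Def. 1.1] -/
theorem ClassX3M.bsdp_rankOne_of_wuthrichHalf_of_delbourgo_of_forall_branchPAdicGrossZagierMult_of_shaAn_unit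
    (hDelM : Delbourgo2002.mainTheorem_potMult)
    (hW16 : Wuthrich2014.thm16_halfEigenCharIdeal_dvd_cyclotomicPrime)
    (hGZK : rank_eq_analyticRank_of_analyticRank_le_one) (hmod : hasEntireLFunction_rat)
    (hmodD : nonempty_modularParametrizationData) (hX : ClassX3M W p) (hr : W.analyticRank = 1)
    (hGZ : ∀ Dh : PAdicHeightData W p, LeadingTermClauses W p Dh →
      SchneiderConjecture Dh ∧ BranchPAdicGrossZagierMultAt W p Dh)
    {q : ℚ} (hq : shaAn W = (q : ℂ)) (hv : padicValRat p q = 0) : BSDp W p := by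
  obtain ⟨-, Dh, hB⟩ := hX.delbourgo2002 hDelM
  obtain ⟨hS, hGZDh⟩ := hGZ Dh hB
  exact ClassX3M.bsdp_rankOne_of_wuthrichHalf_of_branchPAdicGrossZagierMult_of_shaAn_unit hW16 hGZK hmod hmodD hX hr
    hB hS hGZDh hq hv

end Summit.BirchSwinnertonDyer.Rank1Residual.AdditivePotMult

end
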